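import Literature.MathematicalPhysics.QuantumManyBody.DyadicCoherentFraction
import Mathlib.Analysis.SpecialFunctions.Pow.NNReal
import Mathlib.Analysis.SpecificLimits.Basic
import Mathlib.Topology.Algebra.InfiniteSum.Real
import HarnessLib

/-!
# Crux `BECTangentRigidity.TangentTransfer` (stmt-AtomisticToContinuum-13033), line `registered` (v2):
# STUB `stub_chainBookkeeping` — the bookkeeping of the dyadic chaining

Deterministic `ℝ≥0∞` bookkeeping, no physics.  For an `N`-particle wave function `Ψ` in the box of
side `L` write `A m = 8^{-m/2} Σ_i ⟨dyMode L m i, γ_Ψ dyMode L m i⟩^{1/2}` for the coherent amplitude of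
the `8^m` flat dyadic cell modes of level `m` (cell side `L/2^m`).  Hypotheses: a scale `ℓ_d > 0`, a
budget `β ≥ 0` with `Σ_j β_j ≤ 1/4`, and the per-level inequality of the open item
`BECDyadicChaining.DyadicCoherenceDefect` (stmt-AtomisticToContinuum-13192) for this ONE state: whenever
the cell side `L/2^m` (`m ≥ 1`) lies in the dyadic bracket `[ℓ_d 2^j, ℓ_d 2^{j+1})`,
`A m ≤ A (m-1) + β_j √N`.  CLAIM: a base level `n` with `L/2^n ≥ ℓ_d` and `A n ≥ (24/25) √N` forces
`cohSum N L 0 Ψ ≥ N/2`.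

Proof (the bookkeeping of the proved deciding theorem `BECDyadicChaining.closes`, with base constant
`24/25` in place of `1/2`).
1. Every level `m ≤ n` has side `L/2^m ≥ L/2^n ≥ ℓ_d`, so a bracket `j(m)` exists
   (`exists_nat_pow_near` for `(L/2^m)/ℓ_d ≥ 1`).
2. `2^{j(m)+m} ≤ L/ℓ_d < 2^{j(m)+m+1}`, so `j(m) + m` is constant and `m ↦ j(m)` is injective on
   `{1,…,n}`.
3. Telescoping, `A n ≤ A 0 + (Σ_{m=1}^{n} β_{j(m)}) √N` and `Σ_{m=1}^{n} β_{j(m)} = Σ_{j ∈ image} β_j ≤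
   Σ' β ≤ 1/4` (`Finset.sum_image`, `Summable.sum_le_tsum`).
4. With the base, `(24/25) √N ≤ A 0 + √N/4`, hence `(71/100) √N ≤ A 0` (`√N < ⊤`).
5. Level `0` has ONE cell (`Fin 3 → Fin (2^0)` is a subsingleton), so `A 0 = (cohSum N L 0 Ψ)^{1/2}`
   and `cohSum N L 0 Ψ = A 0 · A 0 ≥ (71/100)² N = 0.5041 N ≥ N/2`.

References: folklore (elementary bookkeeping); the objects are those of E. H. Lieb, R. Seiringer,
J. P. Solovej, J. Yngvason, *The Mathematics of the Bose Gas and its Condensation* (2005), §1.2, §2.2.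
-/

noncomputable section

open MeasureTheory Filter Set
open scoped ENNReal NNReal Topology BigOperators

namespace Summit.AtomisticToContinuum.BoseEinsteinCondensation.Cruxes.TangentTransfer.Birth

open Literature.MathematicalPhysics.QuantumManyBody.BoseGas

namespace ChainBookkeeping

/-- Abstract telescoping in `ℝ≥0∞`: if `A m ≤ A (m-1) + b m · S` for `1 ≤ m ≤ K`, then
`A K ≤ A 0 + (Σ_{m=1}^{K} b m) · S`. [folklore] -/
theorem telescope (A b : ℕ → ℝ≥0∞) (S : ℝ≥0∞) (K : ℕ)
    (h : ∀ m, 1 ≤ m → m ≤ K → A m ≤ A (m - 1) + b m * S) :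
    A K ≤ A 0 + (∑ m ∈ Finset.Icc 1 K, b m) * S := by
  induction K with
  | zero => simp
  | succ K ih =>
    have ih' := ih (fun m hm hmK => h m hm (hmK.trans (Nat.le_succ K)))
    calc A (K + 1) ≤ A (K + 1 - 1) + b (K + 1) * S := h (K + 1) (Nat.succ_pos K) le_rfl
      _ = A K + b (K + 1) * S := by rw [Nat.add_sub_cancel]
      _ ≤ (A 0 + (∑ m ∈ Finset.Icc 1 K, b m) * S) + b (K + 1) * S := add_le_add ih' le_rfl
      _ = A 0 + (∑ m ∈ Finset.Icc 1 (K + 1), b m) * S := by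
        rw [Finset.sum_Icc_succ_top (Nat.succ_le_succ (Nat.zero_le K)), add_mul, add_assoc]

/-- The dyadic bracket of a length `x ≥ ℓ > 0`: `ℓ 2^j ≤ x < ℓ 2^{j+1}` for some `j : ℕ`
(`exists_nat_pow_near` applied to `x/ℓ ≥ 1`). [folklore] -/
theorem exists_bracket {ℓ x : ℝ} (hℓ : 0 < ℓ) (hx : ℓ ≤ x) :
    ∃ j : ℕ, ℓ * 2 ^ j ≤ x ∧ x < ℓ * 2 ^ (j + 1) := by
  have hx' : 1 ≤ x / ℓ := by rw [le_div_iff₀ hℓ, one_mul]; exact hx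
  obtain ⟨j, hj1, hj2⟩ := exists_nat_pow_near hx' one_lt_two
  refine ⟨j, ?_, ?_⟩
  · have := (le_div_iff₀ hℓ).mp hj1
    linarith [mul_comm ((2 : ℝ) ^ j) ℓ]
  · have := (div_lt_iff₀ hℓ).mp hj2
    linarith [mul_comm ((2 : ℝ) ^ (j + 1)) ℓ]

end ChainBookkeeping

/-- **STUB `stub_chainBookkeeping` — the bookkeeping of the dyadic chaining** (registered signature of
the line `registered`, skeleton v2, of the crux `TangentTransfer`; the bookkeeping of the proved
deciding theorem `BECDyadicChaining.closes` with base constant `24/25` in place of `1/2`).  For one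
state `Ψ`, a scale `ℓ_d > 0` and a budget `β ≥ 0` with `Σβ ≤ 1/4`: if every level `m ≥ 1` whose cell
side lies in the bracket `[ℓ_d 2^j, ℓ_d 2^{j+1})` has `A_m ≤ A_{m-1} + β_j √N` (the clause of item
stmt-AtomisticToContinuum-13192 over the half-open dyadic cells), and some level `n` with
`L/2^n ≥ ℓ_d` has `A_n ≥ (24/25) √N`, then `cohSum N L 0 Ψ ≥ N/2`.  The bracket index `j(m)` has
`j(m) + m` constant, so it is injective on `1 ≤ m ≤ n` and telescoping gives
`A_n ≤ A_0 + (Σ_{m ≤ n} β_{j(m)}) √N ≤ A_0 + √N/4`; hence `A_0 ≥ (71/100) √N` and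
`cohSum_0 = A_0²` (one cell at level `0`) `≥ (71/100)² N ≥ N/2`. [folklore] -/
theorem stub_chainBookkeeping :
    ∀ (N : ℕ) (L : ℝ) (Ψ : Config N → ℂ) (ℓd : ℝ), 0 < ℓd → 0 < L →
      ∀ β : ℕ → ℝ, (∀ j, 0 ≤ β j) → Summable β → ∑' j, β j ≤ 1 / 4 →
      let A : ℕ → ℝ≥0∞ := fun m => (8 : ℝ≥0∞) ^ (-(m : ℝ) / 2) *
        ∑ i : Fin 3 → Fin (2 ^ m), (occupation N (dyMode L m i) Ψ) ^ (1 / 2 : ℝ)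
      (∀ m j : ℕ, 1 ≤ m → ℓd * 2 ^ j ≤ L / 2 ^ m → L / 2 ^ m < ℓd * 2 ^ (j + 1) →
        A m ≤ A (m - 1) + ENNReal.ofReal (β j) * (N : ℝ≥0∞) ^ (1 / 2 : ℝ)) →
      ∀ n : ℕ, ℓd ≤ L / 2 ^ n →
        ENNReal.ofReal (24 / 25) * (N : ℝ≥0∞) ^ (1 / 2 : ℝ) ≤ A n →
        ENNReal.ofReal ((N : ℝ) / 2) ≤ cohSum N L 0 Ψ := by
  classical
  intro N L Ψ ℓd hℓd hL β hβ0 hβs hβ4 A h1 n hn hbase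
  set S : ℝ≥0∞ := (N : ℝ≥0∞) ^ (1 / 2 : ℝ) with hS
  have hSfin : S ≠ ⊤ := ENNReal.rpow_ne_top_of_nonneg (by norm_num) (ENNReal.natCast_ne_top N)
  -- (1) every level `m ≤ n` has side `≥ ℓd`, hence a bracket `jf m`
  have hscale : ∀ m, m ≤ n → ℓd ≤ L / 2 ^ m := fun m hm =>
    hn.trans (div_le_div_of_nonneg_left hL.le (pow_pos two_pos m) (pow_le_pow_right₀ one_le_two hm))
  have hbr : ∀ m, m ≤ n → ∃ j : ℕ, ℓd * 2 ^ j ≤ L / 2 ^ m ∧ L / 2 ^ m < ℓd * 2 ^ (j + 1) :=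
    fun m hm => ChainBookkeeping.exists_bracket hℓd (hscale m hm)
  choose! jf hjf1 hjf2 using hbr
  -- (2) `jf m + m` is constant in `m`, hence `jf` is injective on the levels `≤ n`
  have hup : ∀ m, m ≤ n → (2 : ℝ) ^ (jf m + m) ≤ L / ℓd := by
    intro m hm
    rw [le_div_iff₀ hℓd]
    have := (le_div_iff₀ (pow_pos two_pos m)).mp (hjf1 m hm)
    calc (2 : ℝ) ^ (jf m + m) * ℓd = ℓd * 2 ^ jf m * 2 ^ m := by rw [pow_add]; ring
      _ ≤ L := this
  have hlow : ∀ m, m ≤ n → L / ℓd < (2 : ℝ) ^ (jf m + m + 1) := by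
    intro m hm
    rw [div_lt_iff₀ hℓd]
    have := (div_lt_iff₀ (pow_pos two_pos m)).mp (hjf2 m hm)
    calc L < ℓd * 2 ^ (jf m + 1) * 2 ^ m := this
      _ = (2 : ℝ) ^ (jf m + m + 1) * ℓd := by rw [pow_add, pow_add, pow_add]; ring
  have hle : ∀ m m', m ≤ n → m' ≤ n → jf m + m ≤ jf m' + m' := by
    intro m m' hm hm'
    by_contra hcon
    have hcon' : jf m' + m' + 1 ≤ jf m + m := by omega
    have h3 : (2 : ℝ) ^ (jf m' + m' + 1) ≤ 2 ^ (jf m + m) := pow_le_pow_right₀ one_le_two hcon'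
    exact absurd ((hup m hm).trans_lt (hlow m' hm')) (not_lt.mpr h3)
  have hinj : ∀ m ∈ Finset.Icc 1 n, ∀ m' ∈ Finset.Icc 1 n, jf m = jf m' → m = m' := by
    intro m hm m' hm' hjj
    rw [Finset.mem_Icc] at hm hm'
    have e1 := hle m m' hm.2 hm'.2
    have e2 := hle m' m hm'.2 hm.2
    omega
  -- (3) the budget spent on the levels `1..n` is at most `Σ β ≤ 1/4`; telescope
  have hsumβ : ∑ m ∈ Finset.Icc 1 n, β (jf m) ≤ 1 / 4 := by
    rw [← Finset.sum_image hinj]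
    exact (hβs.sum_le_tsum _ (fun j _ => hβ0 j)).trans hβ4
  have hsum' : (∑ m ∈ Finset.Icc 1 n, ENNReal.ofReal (β (jf m))) ≤ ENNReal.ofReal (1 / 4) := by
    rw [← ENNReal.ofReal_sum_of_nonneg (fun m _ => hβ0 (jf m))]
    exact ENNReal.ofReal_le_ofReal hsumβ
  have hstep : ∀ m, 1 ≤ m → m ≤ n → A m ≤ A (m - 1) + ENNReal.ofReal (β (jf m)) * S :=
    fun m hm hmn => h1 m (jf m) hm (hjf1 m hmn) (hjf2 m hmn)
  have hAn : A n ≤ A 0 + ENNReal.ofReal (1 / 4) * S :=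
    (ChainBookkeeping.telescope A (fun m => ENNReal.ofReal (β (jf m))) S n hstep).trans
      (add_le_add le_rfl (mul_le_mul' hsum' le_rfl))
  -- (4) with the base: `(24/25 - 1/4) √N ≤ A 0`
  have hmain : ENNReal.ofReal (24 / 25) * S ≤ A 0 + ENNReal.ofReal (1 / 4) * S := hbase.trans hAn
  have h71 : ENNReal.ofReal (71 / 100) * S ≤ A 0 := by
    have hsub : ENNReal.ofReal (71 / 100) = ENNReal.ofReal (24 / 25) - ENNReal.ofReal (1 / 4) := by
      rw [← ENNReal.ofReal_sub _ (by norm_num : (0 : ℝ) ≤ 1 / 4)]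
      norm_num
    rw [hsub, ENNReal.sub_mul (fun _ _ => hSfin)]
    exact tsub_le_iff_right.2 hmain
  -- (5) level `0` is the single cell `[0,L)³`: `cohSum_0 = A 0 · A 0 ≥ (71/100)² N ≥ N/2`
  obtain ⟨i₀⟩ : Nonempty (Fin 3 → Fin (2 ^ 0)) := ⟨fun _ => ⟨0, by norm_num⟩⟩
  have hsub : Subsingleton (Fin 3 → Fin (2 ^ 0)) := by rw [pow_zero]; infer_instance
  have hA0 : A 0 = (occupation N (dyMode L 0 i₀) Ψ) ^ (1 / 2 : ℝ) := by
    have e1 : A 0 = (8 : ℝ≥0∞) ^ (-((0 : ℕ) : ℝ) / 2) *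
        ∑ i : Fin 3 → Fin (2 ^ 0), (occupation N (dyMode L 0 i) Ψ) ^ (1 / 2 : ℝ) := rfl
    rw [e1, Fintype.sum_subsingleton _ i₀]
    simp only [Nat.cast_zero, neg_zero, zero_div, ENNReal.rpow_zero, one_mul]
  have hcoh : cohSum N L 0 Ψ = occupation N (dyMode L 0 i₀) Ψ := by
    unfold cohSum
    exact Fintype.sum_subsingleton _ i₀
  -- `x^{1/2} · x^{1/2} = x` in `ℝ≥0∞`
  have hhalf : ∀ x : ℝ≥0∞, x ^ (1 / 2 : ℝ) * x ^ (1 / 2 : ℝ) = x := fun x => by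
    rw [← ENNReal.rpow_add_of_nonneg _ _ (by norm_num) (by norm_num), add_halves, ENNReal.rpow_one]
  have hSS : S * S = (N : ℝ≥0∞) := by rw [hS]; exact hhalf _
  have hprod : ENNReal.ofReal (71 / 100) * S * (ENNReal.ofReal (71 / 100) * S) ≤ cohSum N L 0 Ψ :=
    calc ENNReal.ofReal (71 / 100) * S * (ENNReal.ofReal (71 / 100) * S) ≤ A 0 * A 0 :=
          mul_le_mul' h71 h71
      _ = cohSum N L 0 Ψ := by rw [hA0, hhalf, hcoh]
  have eL : ENNReal.ofReal (71 / 100) * S * (ENNReal.ofReal (71 / 100) * S) =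
      ENNReal.ofReal (71 / 100 * (71 / 100) * N) := by
    rw [mul_mul_mul_comm, hSS, ENNReal.ofReal_mul (by norm_num : (0 : ℝ) ≤ 71 / 100 * (71 / 100)),
      ENNReal.ofReal_mul (by norm_num : (0 : ℝ) ≤ 71 / 100), ENNReal.ofReal_natCast]
  rw [eL] at hprod
  have hN : (0 : ℝ) ≤ N := Nat.cast_nonneg N
  calc ENNReal.ofReal ((N : ℝ) / 2) ≤ ENNReal.ofReal (71 / 100 * (71 / 100) * N) :=
        ENNReal.ofReal_le_ofReal (by nlinarith)
    _ ≤ cohSum N L 0 Ψ := hprod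

end Summit.AtomisticToContinuum.BoseEinsteinCondensation.Cruxes.TangentTransfer.Birth

end
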